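import Mathlib
import Summits.MatrixMultiplication.Statement
import Summits.MatrixMultiplication.MatrixMultiplication.Theorems.GraphEquationsSectionValues

/-!
# Graph equations — the LEVEL-2 ENGINE of the membership-exponent ladder (e = 3) (M19o)

The exact-members engine one level up (NODE-g32 REV 8–10).  Data: tests `t_o ∈ I` of nonscalar length
`≤ N`; TWO cost-free affine fields `ξ₁, ξ₂`; V0/V1 for the level-1 outputs `D_{ξ₁} t_o` and for the
level-2 outputs `D_{ξ₂} t_o`, `D_{ξ₂} D_{ξ₁} t_o` (supplied base-free by `exists_affField_V01_of_kernelSection`,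
M19n, from exact kernel sections of the row matrices of `t` resp. `t ∪ D_{ξ₁}t`); and, per coordinate `q`,
EITHER an exact cube member `Σ h t = ι(g) f_q³` with the chain alive through both levels
(`g(0) ξ₁,q(0) ξ₂,q(0) ≠ 0`) OR a constant combination of the full output family
`t, D₁t, D₂t, D₂D₁t` equal to `f_q` modulo an osculation-null remainder (the SEMI-FORCED READING —
the one residual of the e-ladder).  Conclusion: `R(⟨n,n,n⟩) ≤ 18 N`.

* `tensorRank_le_of_cubeMembers_affine2` — the level-2 engine (two applications of `exactMember_step_sum`,
  then `tensorRank_le_of_exactMembers_mod` on the family of `4T` outputs, nonscalar length `≤ 9N` by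
  `IsNonscalarSeq.derivC_affine` twice).
-/

set_option linter.dupNamespace false

noncomputable section

open scoped BigOperators

namespace Summit.MatrixMultiplication.MatrixMultiplication.Theorems.GraphEquations

open MvPolynomial
open Literature.Computability.AlgebraicComplexity
open Literature.Computability.AlgebraicComplexity.ArithCircuit

variable {n : ℕ}

/-- **LEVEL-2 ENGINE (e = 3).**  See the module docstring. -/
theorem tensorRank_le_of_cubeMembers_affine2 {N T : ℕ} (t : Fin T → MvPolynomial (GraphVars n) ℂ)
    (hspan : ∃ gs : List (MvPolynomial (GraphVars n) ℂ), IsNonscalarSeq gs ∧ gs.length ≤ N ∧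
      ∀ o, t o ∈ freeSpan {q | q ∈ gs})
    (ht : ∀ o, t o ∈ graphIdeal n)
    (ξ₁ ξ₂ : Fin n × Fin n → MvPolynomial (MatMulVars n) ℂ)
    (hξ₁ : ∀ q, liftAB n (ξ₁ q) ∈ freeSpan (∅ : Set (MvPolynomial (GraphVars n) ℂ)))
    (hξ₂ : ∀ q, liftAB n (ξ₂ q) ∈ freeSpan (∅ : Set (MvPolynomial (GraphVars n) ℂ)))
    (hV0₁ : ∀ o, coeff 0 (derivC ξ₁ (t o)) = 0)
    (hV1₁ : ∀ o (v : MatMulVars n),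
      coeff (Finsupp.single (Sum.inl v : GraphVars n) 1) (derivC ξ₁ (t o)) = 0)
    (hV0₂ : ∀ o, coeff 0 (derivC ξ₂ (t o)) = 0 ∧ coeff 0 (derivC ξ₂ (derivC ξ₁ (t o))) = 0)
    (hV1₂ : ∀ o (v : MatMulVars n),
      coeff (Finsupp.single (Sum.inl v : GraphVars n) 1) (derivC ξ₂ (t o)) = 0 ∧
        coeff (Finsupp.single (Sum.inl v : GraphVars n) 1) (derivC ξ₂ (derivC ξ₁ (t o))) = 0)
    (hq : ∀ q : Fin n × Fin n,
      (coeff 0 (ξ₁ q) ≠ 0 ∧ coeff 0 (ξ₂ q) ≠ 0 ∧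
        ∃ (g : MvPolynomial (MatMulVars n) ℂ) (h : Fin T → MvPolynomial (GraphVars n) ℂ),
          coeff 0 g ≠ 0 ∧ ∑ o, h o * t o = liftAB n g * generator n q ^ 3) ∨
      (∃ (P₀ P₁ P₂ P₃ : Fin T → ℂ) (r : MvPolynomial (GraphVars n) ℂ),
          (∀ q' : Fin n × Fin n, coeff (Finsupp.single (Sum.inr q' : GraphVars n) 1) r = 0) ∧
          (∀ i j j' l : Fin n, coeff (Finsupp.single (Sum.inl (Sum.inl (i, j)) : GraphVars n) 1 +
              Finsupp.single (Sum.inl (Sum.inr (j', l)) : GraphVars n) 1) r = 0) ∧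
          ∑ o, C (P₀ o) * t o + ∑ o, C (P₁ o) * derivC ξ₁ (t o) + ∑ o, C (P₂ o) * derivC ξ₂ (t o) +
              ∑ o, C (P₃ o) * derivC ξ₂ (derivC ξ₁ (t o)) = generator n q + r)) :
    tensorRank (matMulTensor ℂ n n n) ≤ 2 * (9 * N) := by
  classical
  -- the level-1 and level-2 output families
  set p₁ : Fin T ⊕ Fin T → MvPolynomial (GraphVars n) ℂ := Sum.elim t fun o => derivC ξ₁ (t o) with hp₁
  set p : (Fin T ⊕ Fin T) ⊕ (Fin T ⊕ Fin T) → MvPolynomial (GraphVars n) ℂ :=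
    Sum.elim p₁ fun o => derivC ξ₂ (p₁ o) with hp
  -- nonscalar length `≤ 9N`
  obtain ⟨gs, hns, hlen, hmem⟩ := hspan
  obtain ⟨gs₁, hns₁, hlen₁, hsub₁, hD₁⟩ := IsNonscalarSeq.derivC_affine ξ₁ hξ₁ hns
  obtain ⟨gs₂, hns₂, hlen₂, hsub₂, hD₂⟩ := IsNonscalarSeq.derivC_affine ξ₂ hξ₂ hns₁
  have hmem₁ : ∀ o, p₁ o ∈ freeSpan {q | q ∈ gs₁} := by
    rintro (o | o)
    · exact hsub₁ _ (hmem o)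
    · exact hD₁ _ (hmem o)
  have hspan' : ∃ gs' : List (MvPolynomial (GraphVars n) ℂ), IsNonscalarSeq gs' ∧
      gs'.length ≤ 9 * N ∧ ∀ o, p o ∈ freeSpan {q | q ∈ gs'} := by
    refine ⟨gs₂, hns₂, hlen₂.trans (by omega), fun o => ?_⟩
    rcases o with o | o
    · exact hsub₂ _ (hmem₁ o)
    · exact hD₂ _ (hmem₁ o)
  -- (V0), (V1) for the whole family
  have h0 : ∀ o, coeff 0 (p o) = 0 := by
    rintro ((o | o) | (o | o))
    · exact coeff_zero_eq_zero_of_mem_graphIdeal (ht o)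
    · exact hV0₁ o
    · exact (hV0₂ o).1
    · exact (hV0₂ o).2
  have h1 : ∀ o (v : MatMulVars n), coeff (Finsupp.single (Sum.inl v : GraphVars n) 1) (p o) = 0 := by
    rintro ((o | o) | (o | o)) v
    · exact coeff_single_inl_eq_zero_of_mem_graphIdeal (ht o) v
    · exact hV1₁ o v
    · exact (hV1₂ o v).1
    · exact (hV1₂ o v).2
  -- the member identities, coordinate by coordinate
  have hex : ∀ q : Fin n × Fin n, ∃ (hh : (Fin T ⊕ Fin T) ⊕ (Fin T ⊕ Fin T) → MvPolynomial (GraphVars n) ℂ)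
      (uu rr : MvPolynomial (GraphVars n) ℂ), coeff 0 uu ≠ 0 ∧
        (∀ q' : Fin n × Fin n, coeff (Finsupp.single (Sum.inr q' : GraphVars n) 1) rr = 0) ∧
        (∀ i j j' l : Fin n, coeff (Finsupp.single (Sum.inl (Sum.inl (i, j)) : GraphVars n) 1 +
            Finsupp.single (Sum.inl (Sum.inr (j', l)) : GraphVars n) 1) rr = 0) ∧
        ∑ o, hh o * p o = uu * generator n q + rr := by
    intro q
    rcases hq q with ⟨hξ₁q, hξ₂q, g, h, hg, hid⟩ | ⟨P₀, P₁, P₂, P₃, r, hrc, hrab, hid⟩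
    · -- chain alive through both levels: differentiate the cube member twice
      have hid₁ := exactMember_step_sum ξ₁ t h g q 2 hid
      -- repackage the unit as `ι(3 g ξ₁,q)`
      have hid₁' : ∑ o', Sum.elim (fun o => derivC ξ₁ (h o)) h o' * p₁ o' =
          liftAB n (C (((2 + 1 : ℕ) : ℂ)) * (g * ξ₁ q)) * generator n q ^ (1 + 1) := by
        rw [hp₁, hid₁]
        simp only [map_mul, liftAB_C]
      have hid₂ := exactMember_step_sum ξ₂ p₁ (Sum.elim (fun o => derivC ξ₁ (h o)) h)
        (C (((2 + 1 : ℕ) : ℂ)) * (g * ξ₁ q)) q 1 hid₁'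
      refine ⟨Sum.elim (fun o => derivC ξ₂ (Sum.elim (fun o => derivC ξ₁ (h o)) h o))
          (Sum.elim (fun o => derivC ξ₁ (h o)) h),
        C (((1 + 1 : ℕ) : ℂ)) * liftAB n (C (((2 + 1 : ℕ) : ℂ)) * (g * ξ₁ q) * ξ₂ q), 0, ?_,
        fun _ => coeff_zero _, fun _ _ _ _ => coeff_zero _, ?_⟩
      · rw [coeff_zero_mul_eq, coeff_zero_C, coeff_zero_liftAB, coeff_zero_mul_eq, coeff_zero_mul_eq,
          coeff_zero_C, coeff_zero_mul_eq]
        exact mul_ne_zero (by norm_num) (mul_ne_zero (mul_ne_zero (by norm_num) (mul_ne_zero hg hξ₁q)) hξ₂q)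
      · rw [add_zero, hp, hid₂, pow_one]
    · -- served modulo osculation-null by the full output family
      refine ⟨Sum.elim (Sum.elim (fun o => C (P₀ o)) fun o => C (P₁ o))
          (Sum.elim (fun o => C (P₂ o)) fun o => C (P₃ o)), 1, r, by simp, hrc, hrab, ?_⟩
      rw [Fintype.sum_sum_type, Fintype.sum_sum_type, Fintype.sum_sum_type]
      simp only [hp, hp₁, Sum.elim_inl, Sum.elim_inr, one_mul]
      rw [← hid]
      ring
  choose hh uu rr huu hrc hrab hid using hex
  exact tensorRank_le_of_exactMembers_mod p hspan' h0 h1 hh uu huu rr hrc hrab hid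

end Summit.MatrixMultiplication.MatrixMultiplication.Theorems.GraphEquations

end
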